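import Summits.CriticalPhenomena.PercolationContinuityZ3.Theorems.SahiAEPlane
import Summits.CriticalPhenomena.PercolationContinuityZ3.Theorems.SahiAEVersionTransport

/-!
# Finite everywhere-MTP₂ versions of unbounded densities: the property and its transport (Lebesgue plane ⟹ open square)

Support file of the Sahi cell (`prim-sahi`, typer seat, generation 22; `--supports stmt-CriticalPhenomena-4575`).
One definition (`HasFiniteMTP2Versions`), theorems otherwise; no named facts, no sorries.

The planar structure theorem (`Plane.exists_measurable_mtp2_version_of_ae_plane`, Lebesgue measure on `ℝ²`, NO
bounds on the density) is transported to other reference measures exactly as the bounded property was in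
`SahiAEVersionTransport*.lean` (typer g21); only the base case is two-dimensional, the transport is dimension-free:

* `HasFiniteMTP2Versions μ` — every measurable `f : α → (0, ∞)` (finite and non-zero everywhere, no bounds) which
  is MTP₂ on `μ ⊗ μ`-a.e. pair has a measurable FINITE version (`F < ∞`; zeros allowed off a null set) MTP₂ at
  every pair;
* `HasFiniteMTP2Versions.transport` (along an a.e. lattice homomorphism `T` with `T_* μ ∼ ν` and a right inverse
  `R` which is a lattice homomorphism on a full-measure sublattice `S`: version `𝟙_S · (F' ∘ R)`), `.of_equivalent`,
  `hasFiniteMTP2Versions_zero`;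
* `hasFiniteMTP2Versions_volume_plane` — Lebesgue measure on `ℝ²` (the planar structure theorem);
* `HasFiniteMTP2Versions.restrict_openUnitCube` — Lebesgue on `ℝ^ι` ⟹ Lebesgue on the open unit cube
  (coordinatewise sigmoid / logit, as in g21).

The atoms / σ-finite steps and the planar corollaries are in `SahiAEFiniteVersionPi.lean`.  No sorries, no new axioms.
-/

noncomputable section

namespace Summit.CriticalPhenomena.PercolationContinuityZ3.Theorems.SahiAEFourFunctions

open MeasureTheory Set Filter Topology ProbabilityTheory
open scoped ENNReal NNReal

/-! ### The property and its transport -/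

section Transport

/-- **The finite-version property** of a reference measure `μ` on a measurable lattice `α`: every measurable
`f : α → [0,∞]` with `f ≠ 0`, `f ≠ ∞` everywhere (no bounds) which is MTP₂ for `μ ⊗ μ`-almost every pair has a
measurable version `F = f` `μ`-a.e. with `F < ∞` everywhere which is MTP₂ at EVERY pair. [this work] -/
def HasFiniteMTP2Versions {α : Type*} [MeasurableSpace α] [Lattice α] (μ : Measure α) : Prop :=
  ∀ (f : α → ℝ≥0∞), Measurable f → (∀ x, f x ≠ 0) → (∀ x, f x ≠ ∞) →
    (∀ᵐ p ∂μ.prod μ, f p.1 * f p.2 ≤ f (p.1 ⊓ p.2) * f (p.1 ⊔ p.2)) →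
    ∃ F : α → ℝ≥0∞, Measurable F ∧ (∀ x, F x ≠ ∞) ∧ F =ᵐ[μ] f ∧ ∀ x y, F x * F y ≤ F (x ⊓ y) * F (x ⊔ y)

variable {α β : Type*} [MeasurableSpace α] [MeasurableSpace β] [Lattice α] [Lattice β]

/-- **Transport lemma** (as `HasBorelMTP2Versions.transport`, finiteness in place of bounds): `T : α → β` an a.e.
lattice homomorphism with `ν ≪ T_* μ ≪ ν`, `S ⊆ β` a full-measure measurable sublattice on which `R : β → α` is a
lattice homomorphism, `R (T x) = x` a.e.; the version of `f` is `𝟙_S · (F' ∘ R)` for a version `F'` of `f ∘ T`.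
[this work] -/
theorem HasFiniteMTP2Versions.transport {μ : Measure α} {ν : Measure β} [SFinite μ] [SFinite ν]
    (hP : HasFiniteMTP2Versions μ) {T : α → β} {R : β → α} (hT : Measurable T) (hR : Measurable R)
    (hTlat : ∀ᵐ p ∂μ.prod μ, T (p.1 ⊓ p.2) = T p.1 ⊓ T p.2 ∧ T (p.1 ⊔ p.2) = T p.1 ⊔ T p.2)
    (hνT : ν ≪ μ.map T) (hTν : μ.map T ≪ ν) {S : Set β} (hS : MeasurableSet S) (hνS : ν Sᶜ = 0)
    (hSinf : ∀ x ∈ S, ∀ y ∈ S, x ⊓ y ∈ S) (hSsup : ∀ x ∈ S, ∀ y ∈ S, x ⊔ y ∈ S)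
    (hRlat : ∀ x ∈ S, ∀ y ∈ S, R (x ⊓ y) = R x ⊓ R y ∧ R (x ⊔ y) = R x ⊔ R y)
    (hRT : ∀ᵐ x ∂μ, R (T x) = x) : HasFiniteMTP2Versions ν := by
  intro f hf h0 hTop hMTP
  have hqmp : Measure.QuasiMeasurePreserving T μ ν := ⟨hT, hTν⟩
  have hqmp2 : Measure.QuasiMeasurePreserving (Prod.map T T) (μ.prod μ) (ν.prod ν) :=
    MeasureTheory.QuasiMeasurePreserving.prodMap hqmp hqmp
  have hMTP' : ∀ᵐ p ∂μ.prod μ, f (T p.1) * f (T p.2) ≤ f (T (p.1 ⊓ p.2)) * f (T (p.1 ⊔ p.2)) := by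
    filter_upwards [hqmp2.ae hMTP, hTlat] with p hp hl
    rw [hl.1, hl.2]
    exact hp
  obtain ⟨F', hF'm, hF'T, hF'ae, hF'mtp⟩ :=
    hP (f ∘ T) (hf.comp hT) (fun x => h0 (T x)) (fun x => hTop (T x)) hMTP'
  refine ⟨S.indicator (F' ∘ R), (hF'm.comp hR).indicator hS, fun x => ?_, ?_, fun x y => ?_⟩
  · by_cases hx : x ∈ S
    · rw [Set.indicator_of_mem hx]; exact hF'T (R x)
    · rw [Set.indicator_of_notMem hx]; exact ENNReal.zero_ne_top
  · have h1 : ∀ᵐ x ∂μ, F' (R (T x)) = f (T x) := by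
      filter_upwards [hF'ae, hRT] with x hx hxR
      rw [hxR]; exact hx
    have h2 : ∀ᵐ y ∂μ.map T, F' (R y) = f y :=
      (ae_map_iff hT.aemeasurable (measurableSet_eq_fun (hF'm.comp hR) hf)).2 h1
    have h3 : ∀ᵐ y ∂ν, F' (R y) = f y := hνT.ae_le h2
    have h4 : ∀ᵐ y ∂ν, y ∈ S := by
      rw [ae_iff]; simpa only [← Set.compl_setOf, Set.setOf_mem_eq] using hνS
    filter_upwards [h3, h4] with y hy hyS
    simp only [Set.indicator_of_mem hyS, Function.comp_apply, hy]
  · by_cases hx : x ∈ S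
    · by_cases hy : y ∈ S
      · rw [Set.indicator_of_mem hx, Set.indicator_of_mem hy, Set.indicator_of_mem (hSinf x hx y hy),
          Set.indicator_of_mem (hSsup x hx y hy)]
        simp only [Function.comp_apply]
        rw [(hRlat x hx y hy).1, (hRlat x hx y hy).2]
        exact hF'mtp (R x) (R y)
      · rw [Set.indicator_of_notMem hy, mul_zero]; exact zero_le
    · rw [Set.indicator_of_notMem hx, zero_mul]; exact zero_le

/-- Equivalent reference measures have the finite-version property simultaneously. [this work] -/
theorem HasFiniteMTP2Versions.of_equivalent {μ ν : Measure α} [SFinite μ] [SFinite ν]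
    (hP : HasFiniteMTP2Versions μ) (hνμ : ν ≪ μ) (hμν : μ ≪ ν) : HasFiniteMTP2Versions ν :=
  hP.transport (T := id) (R := id) measurable_id measurable_id (Eventually.of_forall fun _ => ⟨rfl, rfl⟩)
    (by rwa [Measure.map_id]) (by rwa [Measure.map_id]) MeasurableSet.univ (by simp) (fun _ _ _ _ => mem_univ _)
    (fun _ _ _ _ => mem_univ _) (fun _ _ _ _ => ⟨rfl, rfl⟩) (Eventually.of_forall fun _ => rfl)

/-- The zero measure has the property trivially (the constant version `1`). [folklore] -/
theorem hasFiniteMTP2Versions_zero : HasFiniteMTP2Versions (0 : Measure α) := by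
  intro f _ _ _ _
  exact ⟨fun _ => 1, measurable_const, fun _ => ENNReal.one_ne_top, ae_zero.le (by simp), fun _ _ => le_rfl⟩

end Transport

/-! ### The base case: Lebesgue measure on the plane -/

/-- **Lebesgue measure on `ℝ²` has the finite-version property** (the planar structure theorem
`Plane.exists_measurable_mtp2_version_of_ae_plane`). [this work] -/
theorem hasFiniteMTP2Versions_volume_plane : HasFiniteMTP2Versions (volume : Measure (Fin 2 → ℝ)) := by
  intro f hf h0 hTop hMTP
  obtain ⟨F, hFm, hFb, hFf, hFmtp⟩ := Plane.exists_measurable_mtp2_version_of_ae_plane f hf h0 hTop hMTP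
  exact ⟨F, hFm, fun x => (hFb x).2, hFf, hFmtp⟩

/-! ### From Lebesgue measure on `ℝ^ι` to the open unit cube -/

section OpenCube

variable {ι : Type*} [Fintype ι]

/-- `sigmoid (log (v * (1 - v)⁻¹)) = v` on `(0,1)`. [folklore] -/
private theorem sigmoid_log_div₃ {v : ℝ} (hv : v ∈ Ioo (0 : ℝ) 1) : Real.sigmoid (Real.log (v * (1 - v)⁻¹)) = v := by
  have hv0 : 0 < v := hv.1
  have hv1 : 0 < 1 - v := by linarith [hv.2]
  rw [Real.sigmoid_def, Real.exp_neg, Real.exp_log (mul_pos hv0 (inv_pos.2 hv1))]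
  field_simp
  ring

/-- `log (sigmoid x / (1 - sigmoid x)) = x`. [folklore] -/
private theorem log_div_sigmoid₃ (x : ℝ) : Real.log (Real.sigmoid x * (1 - Real.sigmoid x)⁻¹) = x :=
  Real.sigmoid_injective (sigmoid_log_div₃ ⟨Real.sigmoid_pos x, Real.sigmoid_lt_one x⟩)

/-- The logit is monotone on `(0,1)`. [folklore] -/
private theorem log_div_le_log_div₃ {u v : ℝ} (hu : u ∈ Ioo (0 : ℝ) 1) (hv : v ∈ Ioo (0 : ℝ) 1) (huv : u ≤ v) :
    Real.log (u * (1 - u)⁻¹) ≤ Real.log (v * (1 - v)⁻¹) := by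
  rw [← Real.sigmoid_le_iff, sigmoid_log_div₃ hu, sigmoid_log_div₃ hv]
  exact huv

/-- **Lebesgue on `ℝ^ι` ⟹ Lebesgue on the open unit cube** for the finite-version property (coordinatewise
sigmoid / logit; the version vanishes off the open cube). [this work] -/
theorem HasFiniteMTP2Versions.restrict_openUnitCube (hP : HasFiniteMTP2Versions (volume : Measure (ι → ℝ))) :
    HasFiniteMTP2Versions ((volume : Measure (ι → ℝ)).restrict (Set.pi univ fun _ => Ioo (0 : ℝ) 1)) := by
  set U : Set (ι → ℝ) := Set.pi univ fun _ => Ioo (0 : ℝ) 1 with hU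
  have mU : MeasurableSet U := MeasurableSet.univ_pi fun _ => measurableSet_Ioo
  set e : (ι → ℝ) → (ι → ℝ) := fun x i => Real.sigmoid (x i) with he
  set L : (ι → ℝ) → (ι → ℝ) := fun y i => Real.log (y i * (1 - y i)⁻¹) with hL
  have he_meas : Measurable e :=
    measurable_pi_iff.2 fun i => continuous_sigmoid.measurable.comp (measurable_pi_apply i)
  have hL_meas : Measurable L :=
    measurable_pi_iff.2 fun i => Real.measurable_log.comp
      ((measurable_pi_apply i).mul (measurable_const.sub (measurable_pi_apply i)).inv)
  have he_mem : ∀ x, e x ∈ U := fun x => Set.mem_univ_pi.2 fun i => ⟨Real.sigmoid_pos _, Real.sigmoid_lt_one _⟩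
  have hLe : ∀ x, L (e x) = x := fun x => funext fun i => log_div_sigmoid₃ (x i)
  have heL : ∀ y ∈ U, e (L y) = y := fun y hy => funext fun i => sigmoid_log_div₃ (Set.mem_univ_pi.1 hy i)
  have he_diff : Differentiable ℝ e :=
    differentiable_pi.2 fun i => differentiable_sigmoid.comp (differentiable_apply i)
  have hL_diff : DifferentiableOn ℝ L U := by
    refine differentiableOn_pi.2 fun i => ?_
    have h1 : DifferentiableOn ℝ (fun y : ι → ℝ => y i) U := (differentiable_apply i).differentiableOn
    have h2 : DifferentiableOn ℝ (fun y : ι → ℝ => 1 - y i) U :=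
      ((differentiable_const (1 : ℝ)).sub (differentiable_apply i)).differentiableOn
    refine (h1.mul (h2.inv fun y hy => ?_)).log fun y hy => ?_
    · have := (Set.mem_univ_pi.1 hy i).2; linarith
    · have h0 := (Set.mem_univ_pi.1 hy i).1
      have h1' : 0 < 1 - y i := by have := (Set.mem_univ_pi.1 hy i).2; linarith
      exact (mul_pos h0 (inv_pos.2 h1')).ne'
  have hν : (volume : Measure (ι → ℝ)).restrict U ≪ (volume : Measure (ι → ℝ)).map e := by
    refine Measure.AbsolutelyContinuous.mk fun s hs h0 => ?_
    rw [Measure.map_apply he_meas hs] at h0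
    rw [Measure.restrict_apply hs]
    have hsub : s ∩ U ⊆ e '' (e ⁻¹' s) := fun y hy => ⟨L y, by
      show e (L y) ∈ s
      rw [heL y hy.2]; exact hy.1, heL y hy.2⟩
    exact measure_mono_null hsub
      (addHaar_image_eq_zero_of_differentiableOn_of_addHaar_eq_zero volume he_diff.differentiableOn h0)
  have hν' : (volume : Measure (ι → ℝ)).map e ≪ (volume : Measure (ι → ℝ)).restrict U := by
    refine Measure.AbsolutelyContinuous.mk fun s hs h0 => ?_
    rw [Measure.restrict_apply hs] at h0
    rw [Measure.map_apply he_meas hs]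
    have hsub : e ⁻¹' s ⊆ L '' (s ∩ U) := fun x hx => ⟨e x, ⟨hx, he_mem x⟩, hLe x⟩
    exact measure_mono_null hsub
      (addHaar_image_eq_zero_of_differentiableOn_of_addHaar_eq_zero volume
        (hL_diff.mono Set.inter_subset_right) h0)
  have hUinf : ∀ x ∈ U, ∀ y ∈ U, x ⊓ y ∈ U := fun x hx y hy => Set.mem_univ_pi.2 fun i =>
    ⟨lt_min (Set.mem_univ_pi.1 hx i).1 (Set.mem_univ_pi.1 hy i).1,
      (min_le_left _ _).trans_lt (Set.mem_univ_pi.1 hx i).2⟩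
  have hUsup : ∀ x ∈ U, ∀ y ∈ U, x ⊔ y ∈ U := fun x hx y hy => Set.mem_univ_pi.2 fun i =>
    ⟨(Set.mem_univ_pi.1 hx i).1.trans_le (le_max_left _ _),
      max_lt (Set.mem_univ_pi.1 hx i).2 (Set.mem_univ_pi.1 hy i).2⟩
  have helat : ∀ x y, e (x ⊓ y) = e x ⊓ e y ∧ e (x ⊔ y) = e x ⊔ e y := fun x y =>
    ⟨funext fun i => Real.sigmoid_monotone.map_inf (x i) (y i),
      funext fun i => Real.sigmoid_monotone.map_sup (x i) (y i)⟩
  have hLlat : ∀ x ∈ U, ∀ y ∈ U, L (x ⊓ y) = L x ⊓ L y ∧ L (x ⊔ y) = L x ⊔ L y := by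
    intro x hx y hy
    have hmono : MonotoneOn (fun v : ℝ => Real.log (v * (1 - v)⁻¹)) (Ioo (0 : ℝ) 1) :=
      fun u hu v hv huv => log_div_le_log_div₃ hu hv huv
    refine ⟨funext fun i => ?_, funext fun i => ?_⟩
    · exact hmono.map_inf (Set.mem_univ_pi.1 hx i) (Set.mem_univ_pi.1 hy i)
    · exact hmono.map_sup (Set.mem_univ_pi.1 hx i) (Set.mem_univ_pi.1 hy i)
  have hUc : ((volume : Measure (ι → ℝ)).restrict U) Uᶜ = 0 := by
    rw [Measure.restrict_apply mU.compl, Set.compl_inter_self, measure_empty]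
  exact hP.transport he_meas hL_meas (Eventually.of_forall fun p => helat p.1 p.2) hν hν' mU hUc hUinf hUsup hLlat
    (Eventually.of_forall hLe)

end OpenCube

end Summit.CriticalPhenomena.PercolationContinuityZ3.Theorems.SahiAEFourFunctions
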